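import Literature.MathematicalPhysics.QuantumFieldTheory.Balaban1983to89.B13TermWalkDataOneTorus

/-!
# `Balaban1983to89.NodeOKernel216` — THE (2.16)-LEVEL RECORD OF ONE TERM, AND OF A MEMBER SET: what the B12-THM2 DAG's
# consumers (NODE A `B13PrimitiveKernels216.h226_torus_of_kernelBounds`, the NE5 spine) READ of NODE O's walk package, with the
# walk format forgotten (T. Bałaban, CMP **116** (1988) [II] = [Balaban1988RG2Cluster] (2.16) p. 16, p. 13–15, (2.26) p. 17)

statement-level skeleton of published theorems with citation tags; proofs where landed; nothing here is a claim about the Yang–Mills mass gap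

CITATION HEADER (lean-in-tree rule).  Ideation cell `ym-nodeO-ideate` (portfolio track, 2026-08-25), seat P3 «weaken the target», memo
`memos/ROUTE-P3.md` v3.15 (sha256 756f0b72…) §2 rows W-sub ∕ W-216 ∕ W-216R, §9 nomination **N2** («the (2.16)-level consumption sockets below
:353»).  LANDING EDITION (generation 14), module 1 of N2, of the memo companion `memos/ROUTE-P3-Sketch.lean` («SK», sha256 54d1589b…,
2948 l., 0 `sorry`, 0 `axiom`; referee REF g18 PASS 2026-08-25T17:49:30Z; director-ym LINE №2 (A)∕(B) «runner-up P3 N2 after N1» — N1 =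
tree `NodeOJetCalculus` p405070): SK §A :51–:68 (`AcrossSmallOn` and its three one-line lemmas), §F.1 :2542–:2669 (`Kernel216`,
`Kernel216.localisation17a` ∕ `differences216` ∕ `weaken` ∕ `of_termWalkData`, `entry_le_of_ref_add_diff`) and §F.2 :2671–:2737 (`AcrossOn216`,
`acrossOn216_mono`, `acrossOn216_of_acrossSmallOn`, `acrossOn216_of_acrossSmall`, **`AcrossOn216.nodeA_inputs`**); the companion
`memos/ROUTE-P3-SketchT21.lean` («T21c», 3050ac2c…) §1 :76–:131 is a VERBATIM COPY of §F.1's `Kernel216` ∕ `localisation17a` ∕ `differences216`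
(verified by diff) and its §3–§4 (`Kernel216R`, …) are module 2 `NodeOKernel216R`.  Statements and proofs below are CHARACTER-IDENTICAL to
SK's; edition deltas = the namespace (`YM.NodeO.P3` → this module's), this header, the import narrowed to `B13TermWalkDataOneTorus` (which
carries `B13TermWalkData`, `B13JointWalkExpansion`, `B13PrimitiveKernels216`), the opens cut to the ones used, per-declaration
`[cite: <key>, <locator>]` tags and docstrings on the four untagged one-line lemmas, and the CUT of SK §F.2's `acrossOn216_of_decoupled` ∕
`AcrossOn216Law` ∕ `acrossOn216Law_of_…` (:2739–:2774; they need SK §A's `AcrossSmallDecoupled` and §E's law classes — nomination N3's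
matter) and of everything else in SK.  LABELS in the docstrings (memo-side words, NOT tree declarations): «NODE O» = the :353 socket
`B13TermWalkDataOneTorus.ExistsUniformAcrossSmall`; «NODE A» = `B13PrimitiveKernels216.h226_torus_of_kernelBounds`; «NE5» ∕ «the spine» =
the Summits-side modules `T4Continuum/Spine/NE5/TwoRunTorus*` (named in docstrings by file name only; nothing of theirs is imported);
«(W-sub)», «(W-216)», «(W-dec)», «(W-law)», «E1» = the memo's row ∕ edge labels; «[II]» = [Balaban1988RG2Cluster] (CMP **116**, tree prefix `B13`);
«(v)» ∕ «(v)⁺» = the NODE-O statement (v) of `B13TermWalkData` ∕ its admissible-and-small family-uniform form (`B13TermWalkDataOneTorus` §4,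
:353); «[B12]» = [Balaban1987RG1] (CMP **109**, tree prefix `B12`; its Thm 2 p. 259 = endpoint existence of the coupling flow, the B12-THM2
DAG's apex-side theorem); «[13]» = reference 13 of [II] = CMP **99** [Balaban1985BackgroundPropagators] (Thm 3.10 ∕ 3.15, real background propagators).

PRINT STATUS (LIT `lit/SOURCES.md` §1.1 ∕ §6).  The located bounds packaged here ARE Bałaban's printed (2.16)-level statements:
[II] p. 13 (uniform majorants of the Γ-kernel), p. 15 (the covariance majorant; u-analyticity of the kernels in the complex background
on the `α`-ball; the smallness of the differences from the real reference kernels), (2.16) p. 16 (the located differences), (2.26) p. 17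
(the input format of Lemma 3's bound), (1.11) p. 5 (the distance `d`); [B9] = [Balaban1985BackgroundPropagators] Thm 3.10 p. 416 (the
real background propagators).  The packaging into ONE `Prop`-valued record per term ∕ one existential over a member set is this
module's (no printed counterpart: Bałaban states the bounds where he uses them); every `[cite:]` tag names the printed bound the
field ∕ lemma TRANSCRIBES.  Proofs: bookkeeping over the tree's `B13PrimitiveKernels216` (`localisation17a_of_majorants` pattern,
`differences216_of_two`, `sub_ref_le_of_analytic`) — [folklore] relative to those landed theorems.

WHAT IS PROVED (sorry-free, axiom-free).
* §A `AcrossSmallOn 𝓣 P α R_σ₀ θ₀` — :353's package asked on a SUBFAMILY `P` of members only (`P = univ` ⟺ :353,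
  `acrossSmallOn_univ_iff`); monotone in `P`.
* §F.1 `Kernel216 𝒦 α κ K_G K_Cs θ_Γ θ_E` — the (2.16)-level content of ONE term's walk package on exactly the consumed domains
  (polydisc × {‖u‖ ≤ α}): majorants `mΓ`, `mC`, located differences `dΓ`, `dE`, u-analyticity `holE`, `holΓ`; it yields NODE A's two
  named inputs `Localisation17a` (`localisation17a`) and `Differences216` at any twice-dropped rate under NODE A's own `hAs hA`
  (`differences216`); it is monotone in its letters (`weaken`); and **NODE O's package implies it** (`of_termWalkData`: E1 run to the
  (2.16) level and stopped there; letters `θ_Γ = 2K̄_Γe^{−εR_σ} + 2K̄_Γα∕R`, `θ_E = 2K̄_Ee^{−εR_σ} + 2K̄_Eα∕R`).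
* §F.2 `AcrossOn216 𝓣 P α θ₀` — common letters for every term of every member of `P`; `(W-sub|P) ⟹ (W-216|P)`
  (`acrossOn216_of_acrossSmallOn`, `SmallTheta` is exactly `θ_Γ, θ_E ≤ θ₀`), NODE O ⟹ (W-216) on all members (`acrossOn216_of_acrossSmall`),
  and **`AcrossOn216.nodeA_inputs`**: (W-216|P) hands NODE A ∕ NE5 their inputs `h17`, `h16`, `haE`, `haΓ` per member ∕ term ∕ configuration,
  BY SHAPE, with letters common to `P` except the derived `θ_C`.

WHAT THIS IS NOT.  NOT an inhabitant of :353 or of any socket declared here; NOT a weakening of the σ-walk content of (v) (`B13TermWalkData`)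
— the same located bounds with the walk letters `R`, `ε`, `R_σ`, `hfar` consumed; NOT a change to NODE A's statement (its hypotheses are
met by name, nothing of NODE A is re-proved); no YM-PLAN ∕ Track-B node is claimed closed and no Track-B number is produced; not
continuum, not mass gap, not Clay.  NEW file, imports built tree modules only; nothing modified.  Net new unproved facts: 0.
[cite: Balaban1988RG2Cluster, (2.16) p.16, p.13, p.15, (2.26) p.17; Balaban1985BackgroundPropagators, Thm 3.10 p.416] -/

noncomputable section

open Set Metric

namespace Literature.MathematicalPhysics.QuantumFieldTheory.Balaban1983to89.NodeOKernel216

open Literature.MathematicalPhysics.QuantumFieldTheory.Balaban1983to89.B13PrimitiveKernels216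
open Literature.MathematicalPhysics.QuantumFieldTheory.Balaban1983to89.B13TermWalkData
open Literature.MathematicalPhysics.QuantumFieldTheory.Balaban1983to89.B13TermWalkDataOneTorus
open Literature.MathematicalPhysics.QuantumFieldTheory.Balaban1983to89.B13JointWalkExpansion
open Literature.MathematicalPhysics.QuantumFieldTheory.Balaban1983to89.TreeLengthTorus (TPt)
open Literature.MathematicalPhysics.QuantumFieldTheory.Balaban1983to89.B9Thm37GlueTorus (tdist1 tdist1_nonneg)
open Literature.MathematicalPhysics.QuantumFieldTheory.Balaban1983to89.B5TorusCover (UT)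

/-! ## §A  (v)⁺ ON A SUBFAMILY OF MEMBERS -/

section NodeO

variable {d : ℕ} {c : B13.Consts}

/-- (W-sub) **(v)⁺ on a SUBFAMILY** `P` of members (the generic shape of every history-class restriction: runs, cone,
tube).  `P = univ` is NODE O itself (:353 `ExistsUniformAcrossSmall`: the NODE-O statement (v) of `B13TermWalkData` in its admissible ∧
small ∧ family-uniform form (v)⁺). [cite: Balaban1988RG2Cluster, (2.16) p.16, p.15] -/
def AcrossSmallOn {S : Type*} (𝓣 : S → TorusTerms c d) (P : Set S) (α Rσ₀ θ₀ : ℝ) : Prop :=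
  ∃ w : WalkConsts, w.Admissible α Rσ₀ ∧ SmallTheta w α θ₀ ∧ ∀ s ∈ P, ∀ i : (𝓣 s).ι, TermWalkData ((𝓣 s).𝒦 i) w

/-- `P = univ` is :353 itself. [cite: Balaban1988RG2Cluster, (2.16) p.16] -/
theorem acrossSmallOn_univ_iff {S : Type*} (𝓣 : S → TorusTerms c d) (α Rσ₀ θ₀ : ℝ) :
    AcrossSmallOn 𝓣 Set.univ α Rσ₀ θ₀ ↔ ExistsUniformAcrossSmall 𝓣 α Rσ₀ θ₀ := by
  constructor
  · rintro ⟨w, hw, hθ, hall⟩; exact ⟨w, hw, hθ, fun s i => hall s (Set.mem_univ s) i⟩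
  · rintro ⟨w, hw, hθ, hall⟩; exact ⟨w, hw, hθ, fun s _ i => hall s i⟩

/-- Monotone in the member set. [cite: Balaban1988RG2Cluster, (2.16) p.16] -/
theorem acrossSmallOn_mono {S : Type*} {𝓣 : S → TorusTerms c d} {P Q : Set S} (hPQ : P ⊆ Q) {α Rσ₀ θ₀ : ℝ}
    (h : AcrossSmallOn 𝓣 Q α Rσ₀ θ₀) : AcrossSmallOn 𝓣 P α Rσ₀ θ₀ :=
  let ⟨w, hw, hθ, hall⟩ := h; ⟨w, hw, hθ, fun s hs i => hall s (hPQ hs) i⟩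

/-- NODE O ⟹ (W-sub|P) for every `P`. [cite: Balaban1988RG2Cluster, (2.16) p.16] -/
theorem acrossSmallOn_of_acrossSmall {S : Type*} {𝓣 : S → TorusTerms c d} {α Rσ₀ θ₀ : ℝ}
    (h : ExistsUniformAcrossSmall 𝓣 α Rσ₀ θ₀) (P : Set S) : AcrossSmallOn 𝓣 P α Rσ₀ θ₀ :=
  acrossSmallOn_mono (Set.subset_univ P) ((acrossSmallOn_univ_iff 𝓣 α Rσ₀ θ₀).2 h)

end NodeO

/-! ## §F.1  The (2.16)-level record of one term and its two directions -/

section Cut216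

variable {d : ℕ} {c : B13.Consts} {N' ν : ℕ} {Nf : Fin ν → ℕ} [∀ i, NeZero (Nf i)]
variable {E : Type*} [NormedAddCommGroup E] [NormedSpace ℂ E]

/-- (W-216, ONE TERM) **THE (2.16)-LEVEL CONTENT OF A WALK PACKAGE**: what NODE A and NE5 read of `TermWalkData 𝒦 w`, with the
walk format forgotten, on exactly the consumed domains — the uniform majorants of the Γ-kernel and of the covariance on polydisc
× {‖u‖ ≤ α} ([II] p.13, p.15), the located differences (2.16) for `Γ` and for the PRECISION at full rate on polydisc × {‖u‖ ≤ α}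
(Schwarz part included), and u-analyticity of the entries on the open `α`-ball ([II] p.15).  Letters only; a `Prop`-valued
hypothesis SHAPE.
[cite: Balaban1988RG2Cluster, (2.16) p.16, p.15, p.13] -/
structure Kernel216 (𝒦 : TermKernels c d N' ν Nf E) (α kap KG KCs θΓ θE : ℝ) : Prop where
  mΓ : ∀ σ : TPt d N' → ℂ, (∀ j, ‖σ j‖ ≤ Real.exp c.κ₁) → ∀ u : E, ‖u‖ ≤ α →
    ∀ b j, ‖𝒦.G2 σ u b j‖ ≤ KG * Real.exp (-(kap * tdist1 Nf (𝒦.locΛ b) (𝒦.locN j)))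
  mC : ∀ σ : TPt d N' → ℂ, (∀ j, ‖σ j‖ ≤ Real.exp c.κ₁) → ∀ u : E, ‖u‖ ≤ α →
    ∀ b b', ‖(𝒦.A2 σ u)⁻¹ b b'‖ ≤ KCs * Real.exp (-(kap * tdist1 Nf (𝒦.locΛ b) (𝒦.locΛ b')))
  dΓ : ∀ σ : TPt d N' → ℂ, (∀ j, ‖σ j‖ ≤ Real.exp c.κ₁) → ∀ u : E, ‖u‖ ≤ α →
    ∀ b j, ‖(𝒦.G2 σ u - 𝒦.Γ₀.map (algebraMap ℝ ℂ)) b j‖ ≤ θΓ * Real.exp (-(kap * tdist1 Nf (𝒦.locΛ b) (𝒦.locN j)))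
  dE : ∀ σ : TPt d N' → ℂ, (∀ j, ‖σ j‖ ≤ Real.exp c.κ₁) → ∀ u : E, ‖u‖ ≤ α →
    ∀ b b', ‖(𝒦.A2 σ u - 𝒦.C⁻¹.map (algebraMap ℝ ℂ)) b b'‖ ≤ θE * Real.exp (-(kap * tdist1 Nf (𝒦.locΛ b) (𝒦.locΛ b')))
  holE : JointWalkExpansion.AnalyticOnBall c 𝒦.A2 α
  holΓ : JointWalkExpansion.AnalyticOnBall c 𝒦.G2 α

namespace Kernel216

variable {𝒦 : TermKernels c d N' ν Nf E} {α kap KG KCs θΓ θE : ℝ}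

/-- **The record ⟹ NODE A's first named input** (`h17 : Localisation17a` at every `‖u‖ ≤ α`, letters
`(K_G, K_Γ, K_Cs, K₀) = (K_G, K_G, K_Cs, K_Cs)`; the reference fields `hΓ₀`, `hC216` derived from the majorants at `(0,0)` through
`G(0,0) = Γ₀`, `A(0,0)⁻¹ = C` — the pattern of `localisation17a_of_majorants`). [cite: Balaban1988RG2Cluster, p.13, p.15] -/
theorem localisation17a (h : Kernel216 𝒦 α kap KG KCs θΓ θE) (hα : 0 ≤ α) {u : E} (hu : ‖u‖ ≤ α) :
    Localisation17a c (fun σ => 𝒦.A2 σ u) (fun σ => 𝒦.G2 σ u) 𝒦.Γ₀ 𝒦.C 𝒦.locΛ 𝒦.locN kap KG KG KCs KCs := by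
  have h0 : ∀ j, ‖(0 : TPt d N' → ℂ) j‖ ≤ Real.exp c.κ₁ := fun _ => by
    rw [Pi.zero_apply, norm_zero]; exact (Real.exp_pos _).le
  have h00 : ‖(0 : E)‖ ≤ α := by rw [norm_zero]; exact hα
  refine ⟨fun σ hσ b j => h.mΓ σ hσ u hu b j, fun b j => ?_, fun σ hσ b b' => h.mC σ hσ u hu b b', fun b b' => ?_⟩
  · have h1 := h.mΓ 0 h0 0 h00 b j
    rwa [𝒦.hG0, Matrix.map_apply, Complex.coe_algebraMap, Complex.norm_real] at h1
  · have h1 := h.mC 0 h0 0 h00 b b'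
    rwa [𝒦.hC0, Matrix.map_apply, Complex.coe_algebraMap, Complex.norm_real] at h1

/-- **The record ⟹ NODE A's second named input** (`h16 : Differences216` at any twice-dropped rate `0 ≤ κ″ < κ′ < κ`, at every
`‖u‖ ≤ α` at which the precision is symmetric with `Re ≻ 0` — NODE A's own hypotheses `hAs hA`, [II] p.15 — with the DERIVED
covariance letter `θ_C = K_Cs·θ_E·(m(1+2/(κ−κ′))^ν)·K_Cs·(m(1+2/(κ′−κ″))^ν)`; tree's `differences216_of_two`).
[cite: Balaban1988RG2Cluster, (2.16) p.16, (1.11) p.5] -/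
theorem differences216 (h : Kernel216 𝒦 α kap KG KCs θΓ θE) (hα : 0 ≤ α)
    {kap' kap'' : ℝ} (hkap'' : 0 ≤ kap'') (h1 : kap'' < kap') (h2 : kap' < kap)
    (hKCs : 0 ≤ KCs) (hθΓ : 0 ≤ θΓ) (hθE : 0 ≤ θE) {u : E} (hu : ‖u‖ ≤ α)
    (hAs : ∀ σ : TPt d N' → ℂ, (∀ j, ‖σ j‖ ≤ Real.exp c.κ₁) → (𝒦.A2 σ u).IsSymm)
    (hA : ∀ σ : TPt d N' → ℂ, (∀ j, ‖σ j‖ ≤ Real.exp c.κ₁) → ((𝒦.A2 σ u).map Complex.re).PosDef) :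
    Differences216 c (fun σ => 𝒦.A2 σ u) (fun σ => 𝒦.G2 σ u) 𝒦.Γ₀ 𝒦.C 𝒦.locΛ 𝒦.locN kap'' θΓ
      (KCs * θE * (𝒦.m * (1 + 2 / (kap - kap')) ^ ν) * KCs * (𝒦.m * (1 + 2 / (kap' - kap'')) ^ ν)) θE :=
  differences216_of_two c 𝒦.hC hAs hA 𝒦.locΛ 𝒦.locN 𝒦.hfib hkap'' h1 h2 hKCs hKCs hθΓ hθE
    (h.localisation17a hα hu) (fun σ hσ => h.dΓ σ hσ u hu) (fun σ hσ => h.dE σ hσ u hu)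

/-- Monotone in the letters: lower the rate, raise the constants (`0 ≤ K_G, K_Cs, θ_Γ, θ_E`). [cite: Balaban1988RG2Cluster, (2.16) p.16, p.13] -/
theorem weaken (h : Kernel216 𝒦 α kap KG KCs θΓ θE) (hKG : 0 ≤ KG) (hKCs : 0 ≤ KCs) (hθΓ : 0 ≤ θΓ) (hθE : 0 ≤ θE)
    {kap' KG' KCs' θΓ' θE' : ℝ} (hk : kap' ≤ kap) (h1 : KG ≤ KG') (h2 : KCs ≤ KCs') (h3 : θΓ ≤ θΓ') (h4 : θE ≤ θE') :
    Kernel216 𝒦 α kap' KG' KCs' θΓ' θE' := by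
  have hex : ∀ a b : UT Nf, Real.exp (-(kap * tdist1 Nf a b)) ≤ Real.exp (-(kap' * tdist1 Nf a b)) := fun a b =>
    Real.exp_le_exp.2 (neg_le_neg (mul_le_mul_of_nonneg_right hk (tdist1_nonneg _ _)))
  refine ⟨fun σ hσ u hu b j => (h.mΓ σ hσ u hu b j).trans ?_, fun σ hσ u hu b b' => (h.mC σ hσ u hu b b').trans ?_,
    fun σ hσ u hu b j => (h.dΓ σ hσ u hu b j).trans ?_, fun σ hσ u hu b b' => (h.dE σ hσ u hu b b').trans ?_,
    h.holE, h.holΓ⟩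
  · exact mul_le_mul h1 (hex _ _) (Real.exp_pos _).le (hKG.trans h1)
  · exact mul_le_mul h2 (hex _ _) (Real.exp_pos _).le (hKCs.trans h2)
  · exact mul_le_mul h3 (hex _ _) (Real.exp_pos _).le (hθΓ.trans h3)
  · exact mul_le_mul h4 (hex _ _) (Real.exp_pos _).le (hθE.trans h4)

/-- **NODE O's package ⟹ the record** (E1 run to the (2.16) level and STOPPED there: `majorants` on the `w.R`-ball ⊇ {‖u‖ ≤ α},
`sub_ref_sigma` rewritten through the real references `G(0,0) = Γ₀` and — derived from `A(0,0)⁻¹ = C`, `C ≻ 0` — `A(0,0) = C⁻¹`,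
then the Schwarz lemma `sub_ref_le_of_analytic`; `analyticOnBall` restricted to the `α`-ball).  Letters: `κ = w.κ`, `K_G = K̄_Γ`,
`K_Cs = K̄_C`, `θ_Γ = 2K̄_Γe^{−εR_σ} + 2K̄_Γα/R`, `θ_E = 2K̄_Ee^{−εR_σ} + 2K̄_Eα/R`; `R`, `ε`, `R_σ`, `K̄_E` and `hfar` do not
survive as letters. [cite: Balaban1988RG2Cluster, (2.16) p.16, p.15, p.13; Balaban1985BackgroundPropagators, Thm 3.10 p.416] -/
theorem of_termWalkData {w : WalkConsts} {Rσ₀ : ℝ} (hw : w.Admissible α Rσ₀) (hα : 0 ≤ α)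
    (h : TermWalkData 𝒦 w) :
    Kernel216 𝒦 α w.kap w.KbarΓ w.KbarC
      (2 * w.KbarΓ * Real.exp (-(w.ε * w.Rσ)) + 2 * w.KbarΓ * α / w.R)
      (2 * w.KbarE * Real.exp (-(w.ε * w.Rσ)) + 2 * w.KbarE * α / w.R) := by
  obtain ⟨WΓ, TΓ, SXΓ, AΓ, DΓ, ρΓ, hΓ⟩ := h.hΓ
  obtain ⟨WE, TE, SXE, AE, DE, ρE, hE⟩ := h.hE
  obtain ⟨WC, TC, AC, DC, ρC, hC⟩ := h.hCov
  have hR : 0 < w.R := hα.trans_lt hw.hαR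
  have hball : ∀ u : E, ‖u‖ ≤ α → u ∈ ball (0 : E) w.R := fun u hu => mem_ball_zero_iff.2 (hu.trans_lt hw.hαR)
  -- the reference precision identity `A(0,0) = C⁻¹` (pattern of `differences216_of_analytic_two`)
  have hE0 : 𝒦.A2 0 0 = 𝒦.C⁻¹.map (algebraMap ℝ ℂ) := by
    have hCu : IsUnit 𝒦.C.det := 𝒦.hC.det_pos.ne'.isUnit
    have hmul : 𝒦.C⁻¹.map (algebraMap ℝ ℂ) * 𝒦.C.map (algebraMap ℝ ℂ) = 1 := by
      rw [← Matrix.map_mul, Matrix.nonsing_inv_mul 𝒦.C hCu, Matrix.map_one _ (map_zero _) (map_one _)]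
    have hCmu : IsUnit (𝒦.C.map (algebraMap ℝ ℂ)) :=
      (Matrix.isUnit_iff_isUnit_det _).2 (Matrix.isUnit_det_of_left_inverse hmul)
    have hAu : IsUnit (𝒦.A2 0 0).det := by
      rw [← Matrix.isUnit_iff_isUnit_det, ← Matrix.isUnit_nonsing_inv_iff, 𝒦.hC0]; exact hCmu
    rw [← Matrix.nonsing_inv_nonsing_inv (𝒦.A2 0 0) hAu, 𝒦.hC0]
    exact Matrix.inv_eq_left_inv hmul
  refine ⟨fun σ hσ u hu => hΓ.majorants hw.hε σ hσ u (hball u hu), fun σ hσ u hu => hC.majorants σ hσ u (hball u hu),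
    ?_, ?_, fun σ hσ b b' => (hE.analyticOnBall hw.hε σ hσ b b').mono (ball_subset_ball hw.hαR.le),
    fun σ hσ b j => (hΓ.analyticOnBall hw.hε σ hσ b j).mono (ball_subset_ball hw.hαR.le)⟩
  · intro σ hσ u hu b j
    have hσ' : ∀ b j, ‖(𝒦.G2 σ 0 - 𝒦.Γ₀.map (algebraMap ℝ ℂ)) b j‖
        ≤ 2 * w.KbarΓ * Real.exp (-(w.ε * w.Rσ)) * Real.exp (-(w.kap * tdist1 Nf (𝒦.locΛ b) (𝒦.locN j))) := by
      rw [← 𝒦.hG0]; exact hΓ.sub_ref_sigma hR hw.hε h.hfar σ hσ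
    exact sub_ref_le_of_analytic (K := 𝒦.G2 σ) hR hw.hKbarΓ hw.hαR (fun b j => (Real.exp_pos _).le) hσ'
      (hΓ.analyticOnBall hw.hε σ hσ) (hΓ.majorants hw.hε σ hσ) hu b j
  · intro σ hσ u hu b b'
    have hσ' : ∀ b b', ‖(𝒦.A2 σ 0 - 𝒦.C⁻¹.map (algebraMap ℝ ℂ)) b b'‖
        ≤ 2 * w.KbarE * Real.exp (-(w.ε * w.Rσ)) * Real.exp (-(w.kap * tdist1 Nf (𝒦.locΛ b) (𝒦.locΛ b'))) := by
      rw [← hE0]; exact hE.sub_ref_sigma hR hw.hε h.hfar σ hσ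
    exact sub_ref_le_of_analytic (K := 𝒦.A2 σ) hR hw.hKbarE hw.hαR (fun b b' => (Real.exp_pos _).le) hσ'
      (hE.analyticOnBall hw.hε σ hσ) (hE.majorants hw.hε σ hσ) hu b b'

end Kernel216

/-- Triangle (the five independent primitives): on `‖u‖ ≤ α` the Γ-majorant is implied by the REAL reference localisation
`‖Γ₀‖ ≤ K e^{−κd}` plus the difference `dΓ` — so at a consumed configuration the independent (2.16)-level content is
{`hΓ₀`, `hC216` (real background, [13] Thm 3.15), `mC` (complex uniform covariance), `dΓ`, `dE`} ([folklore] triangle inequality).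
[cite: Balaban1988RG2Cluster, p.13, p.15] -/
theorem entry_le_of_ref_add_diff {p n : Type*} {G : Matrix p n ℂ} {G₀ : Matrix p n ℝ} {g : p → n → ℝ} {K θ : ℝ}
    (h0 : ∀ i j, ‖G₀ i j‖ ≤ K * g i j) (hd : ∀ i j, ‖(G - G₀.map (algebraMap ℝ ℂ)) i j‖ ≤ θ * g i j) (i : p) (j : n) :
    ‖G i j‖ ≤ (K + θ) * g i j := by
  have h2 : ‖(G₀.map (algebraMap ℝ ℂ)) i j‖ = ‖G₀ i j‖ := by
    rw [Matrix.map_apply, Complex.coe_algebraMap, Complex.norm_real]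
  calc ‖G i j‖ = ‖(G - G₀.map (algebraMap ℝ ℂ)) i j + (G₀.map (algebraMap ℝ ℂ)) i j‖ := by
        rw [Matrix.sub_apply, sub_add_cancel]
    _ ≤ ‖(G - G₀.map (algebraMap ℝ ℂ)) i j‖ + ‖(G₀.map (algebraMap ℝ ℂ)) i j‖ := norm_add_le _ _
    _ ≤ θ * g i j + K * g i j := add_le_add (hd i j) (by rw [h2]; exact h0 i j)
    _ = (K + θ) * g i j := by ring

/-! ## §F.2  (W-216|P): the (2.16)-level statement on a member set, implied by (W-sub|P), feeding NODE A verbatim -/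

/-- (W-216|P) **NODE O WITHOUT WALKS ON A MEMBER SET `P`**: common letters `R > α`, `κ > 0`, `K_G, K_Cs ≥ 0` and smallness
letters `0 ≤ θ_Γ, θ_E ≤ θ₀` such that every term of every member of `P` satisfies `Kernel216`.  No `WalkConsts`, no `R_σ`, no
drop `ε`: the geometric clause `hfar` and the σ-drop are consumed INSIDE `θ_• ≤ θ₀`.  `P = univ` is (W-216); `P = LawMembers …`
is (W-216) ∘ (W-law). [cite: Balaban1988RG2Cluster, (2.16) p.16, p.15] -/
def AcrossOn216 {S : Type*} (𝓣 : S → TorusTerms c d) (P : Set S) (α θ₀ : ℝ) : Prop :=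
  ∃ kap KG KCs θΓ θE : ℝ, 0 < kap ∧ 0 ≤ KG ∧ 0 ≤ KCs ∧ 0 ≤ θΓ ∧ 0 ≤ θE ∧ θΓ ≤ θ₀ ∧ θE ≤ θ₀ ∧
    ∀ s ∈ P, ∀ i : (𝓣 s).ι, Kernel216 ((𝓣 s).𝒦 i) α kap KG KCs θΓ θE

/-- Monotone in the member set. [cite: Balaban1988RG2Cluster, (2.16) p.16] -/
theorem acrossOn216_mono {S : Type*} {𝓣 : S → TorusTerms c d} {P Q : Set S} {α θ₀ : ℝ} (hPQ : P ⊆ Q)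
    (h : AcrossOn216 𝓣 Q α θ₀) : AcrossOn216 𝓣 P α θ₀ := by
  obtain ⟨kap, KG, KCs, θΓ, θE, h2, h3, h4, h5, h6, h7, h8, hall⟩ := h
  exact ⟨kap, KG, KCs, θΓ, θE, h2, h3, h4, h5, h6, h7, h8, fun s hs i => hall s (hPQ hs) i⟩

/-- **(W-sub|P) ⟹ (W-216|P)** (`0 ≤ α`): NODE O's one small admissible package, run through `Kernel216.of_termWalkData`
termwise; `SmallTheta` is exactly `θ_Γ, θ_E ≤ θ₀`. [cite: Balaban1988RG2Cluster, (2.16) p.16, p.13, p.15] -/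
theorem acrossOn216_of_acrossSmallOn {S : Type*} {𝓣 : S → TorusTerms c d} {P : Set S} {α Rσ₀ θ₀ : ℝ} (hα : 0 ≤ α)
    (h : AcrossSmallOn 𝓣 P α Rσ₀ θ₀) : AcrossOn216 𝓣 P α θ₀ := by
  obtain ⟨w, hw, hθ, hall⟩ := h
  have hR : 0 < w.R := hα.trans_lt hw.hαR
  have hKΓ := hw.hKbarΓ
  have hKE := hw.hKbarE
  refine ⟨w.kap, w.KbarΓ, w.KbarC, 2 * w.KbarΓ * Real.exp (-(w.ε * w.Rσ)) + 2 * w.KbarΓ * α / w.R,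
    2 * w.KbarE * Real.exp (-(w.ε * w.Rσ)) + 2 * w.KbarE * α / w.R, hw.hkap, hw.hKbarΓ, hw.hKbarC,
    by positivity, by positivity, ?_, ?_, fun s hs i => Kernel216.of_termWalkData hw hα (hall s hs i)⟩
  · calc 2 * w.KbarΓ * Real.exp (-(w.ε * w.Rσ)) + 2 * w.KbarΓ * α / w.R
          = 2 * w.KbarΓ * (Real.exp (-(w.ε * w.Rσ)) + α / w.R) := by ring
      _ ≤ θ₀ := hθ.hΓ
  · calc 2 * w.KbarE * Real.exp (-(w.ε * w.Rσ)) + 2 * w.KbarE * α / w.R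
          = 2 * w.KbarE * (Real.exp (-(w.ε * w.Rσ)) + α / w.R) := by ring
      _ ≤ θ₀ := hθ.hE

/-- NODE O ⟹ (W-216) on all members. [cite: Balaban1988RG2Cluster, (2.16) p.16, p.13, p.15] -/
theorem acrossOn216_of_acrossSmall {S : Type*} {𝓣 : S → TorusTerms c d} {α Rσ₀ θ₀ : ℝ} (hα : 0 ≤ α)
    (h : ExistsUniformAcrossSmall 𝓣 α Rσ₀ θ₀) : AcrossOn216 𝓣 Set.univ α θ₀ :=
  acrossOn216_of_acrossSmallOn hα ((acrossSmallOn_univ_iff 𝓣 α Rσ₀ θ₀).2 h)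

/-- **(W-216|P) FEEDS NODE A AND NE5 VERBATIM**: for every member of `P`, every term and every configuration, the two named
inputs of `h226_torus_of_kernelBounds` (:162) ∕ `TwoRunTorusWalkH226` (:146–155) — `h17` and `h16` (any twice-dropped rate, under NODE A's `hAs hA`) at every
`‖u‖ ≤ α` — and the u-analyticity on the open `α`-ball `TwoRunTorusWalkParam` (:184–187, `.mono (ball_subset_ball _)`) reads, with
letters common to the whole of `P` except the DERIVED `θ_C`, which carries the term's own fibre multiplicity `m` and the
member's torus factor count `ν` (both NODE A numerics inputs anyway: `hfibΛ`, `hθR1le`, `hvol`).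
[cite: Balaban1988RG2Cluster, (2.16) p.16, (2.26) p.17, p.15] -/
theorem AcrossOn216.nodeA_inputs {S : Type*} {𝓣 : S → TorusTerms c d} {P : Set S} {α θ₀ : ℝ} (hα : 0 ≤ α)
    (h : AcrossOn216 𝓣 P α θ₀) :
    ∃ kap KG KCs θΓ θE : ℝ, 0 < kap ∧ 0 ≤ KG ∧ 0 ≤ KCs ∧ 0 ≤ θΓ ∧ 0 ≤ θE ∧ θΓ ≤ θ₀ ∧ θE ≤ θ₀ ∧
      ∀ s ∈ P, ∀ i : (𝓣 s).ι,
        (∀ u : (𝓣 s).E, ‖u‖ ≤ α →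
          Localisation17a c (fun σ => ((𝓣 s).𝒦 i).A2 σ u) (fun σ => ((𝓣 s).𝒦 i).G2 σ u) ((𝓣 s).𝒦 i).Γ₀
            ((𝓣 s).𝒦 i).C ((𝓣 s).𝒦 i).locΛ ((𝓣 s).𝒦 i).locN kap KG KG KCs KCs) ∧
        (∀ kap' kap'' : ℝ, 0 ≤ kap'' → kap'' < kap' → kap' < kap → ∀ u : (𝓣 s).E, ‖u‖ ≤ α →
          (∀ σ : TPt d (𝓣 s).N' → ℂ, (∀ j, ‖σ j‖ ≤ Real.exp c.κ₁) → (((𝓣 s).𝒦 i).A2 σ u).IsSymm) →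
          (∀ σ : TPt d (𝓣 s).N' → ℂ, (∀ j, ‖σ j‖ ≤ Real.exp c.κ₁) → ((((𝓣 s).𝒦 i).A2 σ u).map Complex.re).PosDef) →
          Differences216 c (fun σ => ((𝓣 s).𝒦 i).A2 σ u) (fun σ => ((𝓣 s).𝒦 i).G2 σ u) ((𝓣 s).𝒦 i).Γ₀
            ((𝓣 s).𝒦 i).C ((𝓣 s).𝒦 i).locΛ ((𝓣 s).𝒦 i).locN kap'' θΓ
            (KCs * θE * (((𝓣 s).𝒦 i).m * (1 + 2 / (kap - kap')) ^ (𝓣 s).ν) * KCs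
              * (((𝓣 s).𝒦 i).m * (1 + 2 / (kap' - kap'')) ^ (𝓣 s).ν)) θE) ∧
        JointWalkExpansion.AnalyticOnBall c ((𝓣 s).𝒦 i).A2 α ∧
        JointWalkExpansion.AnalyticOnBall c ((𝓣 s).𝒦 i).G2 α := by
  obtain ⟨kap, KG, KCs, θΓ, θE, hkap, hKG, hKCs, hθΓ, hθE, hΓθ, hEθ, hall⟩ := h
  refine ⟨kap, KG, KCs, θΓ, θE, hkap, hKG, hKCs, hθΓ, hθE, hΓθ, hEθ, fun s hs i => ⟨?_, ?_, ?_, ?_⟩⟩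
  · exact fun u hu => (hall s hs i).localisation17a hα hu
  · exact fun kap' kap'' hkap'' h1 h2 u hu hAs hA =>
      (hall s hs i).differences216 hα hkap'' h1 h2 hKCs hθΓ hθE hu hAs hA
  · exact (hall s hs i).holE
  · exact (hall s hs i).holΓ

end Cut216

end Literature.MathematicalPhysics.QuantumFieldTheory.Balaban1983to89.NodeOKernel216

end
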